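import Literature.Geometry.Lorentzian.HessianLocalMax
import Literature.Geometry.Lorentzian.CoordOrthonormalEigenframe
import Literature.Geometry.Lorentzian.TrilinearNormSq
import Mathlib.LinearAlgebra.BilinearForm.Orthogonal
import HarnessLib

/-!
# The elliptic maximum principle on a closed manifold for operators with negative zeroth-order
# term: the a priori bound `c₀ sup|φ| ≤ sup|𝓛φ|` and triviality of the kernel

Support file (everything PROVED; no definition, no named fact) for the named fact
`Literature.Geometry.Riemannian.gurskyViaclovsky_pathOpen_weighted_four`
(`GurskyViaclovskyOpenness.lean`): the uniqueness half of Gursky–Viaclovsky 2003, Prop. 2 —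
"Since the coefficient of `φ` in the zeroth-order term of (ker2) is strictly negative, the
linearization is furthermore invertible on the stated Hölder spaces (see [GT])" — is the
elementary maximum principle for a linear second-order operator
`𝓛φ = ⟨P, Hess_g φ⟩_g + dφ(b) + c φ` on a CLOSED manifold with `P ≥ 0` (degenerate ellipticity
suffices) and `c ≤ −c₀ < 0`: at a positive maximum of `φ`, `dφ = 0` and `Hess_g φ ≤ 0`, so
`𝓛φ ≤ cφ ≤ −c₀ φ` there (Gilbarg–Trudinger 2001, Thm. 3.7 and Cor. 3.8 are the versions for
domains, with a barrier; on a closed manifold no barrier is needed). In the tree's vocabulary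
(`innerBilin`, `hessian`, Mathlib's `mvfderiv`):

* `innerBilin_nonpos_of_nonpos`, `innerBilin_nonneg_of_nonneg` — **`⟨P, H⟩_g ≤ 0` for `P`
  symmetric positive semidefinite and `H(v,v) ≤ 0`** (and the mirror statement), through a
  `g_x`-orthonormal eigenframe of `P` (`MetricCoord.exists_orthonormal_eigenframe`) and the frame
  formula `innerBilin_eq_sum_mul`;
* `mvfderiv_eq_zero_of_isLocalMax` / `…_isLocalMin` — Fermat on a boundaryless manifold for the
  covector-valued differential (`IsLocalMax.isMCriticalPt`, `MorseExtrema.lean`);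
* `mul_abs_le_of_maximumPrinciple` — **the a priori estimate**: on a compact boundaryless `M`
  with `g` Riemannian, if `|⟨P, Hess φ⟩_g + dφ(b) + cφ| ≤ B` everywhere for a `C²` function `φ`,
  `P` symmetric `≥ 0`, `c ≤ −c₀ < 0`, then `c₀|φ| ≤ B` everywhere;
* `eq_zero_of_maximumPrinciple` — **`Ker 𝓛 ∩ C²(M) = 0`**, the injectivity in GV Prop. 2.

The surjectivity half of Prop. 2 (Schauder theory / Fredholm alternative in `C^{2,α}`, e.g.
Joyce 2007, Thms. 1.4.1 and 1.5.3) is NOT in the tree; together with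
`mul_abs_le_of_maximumPrinciple` it would give `‖φ‖_{C^{2,α}} ≤ C‖𝓛φ‖_{C^α}` and the
isomorphism `𝓛 : C^{2,α} → C^α`.

## References

* M. J. Gursky, J. A. Viaclovsky, J. Differential Geom. 63 (2003) 131–154, arXiv:math/0301350,
  §2, proof of Prop. 2. [GurskyViaclovsky2003]
* D. Gilbarg, N. S. Trudinger, *Elliptic partial differential equations of second order* (2001),
  §3.1, Thm. 3.7, Cor. 3.8. [GilbargTrudinger2001]
* B. O'Neill, *Semi-Riemannian geometry* (1983), Ch. 9, Lemma 9.13 (self-adjoint operators for a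
  positive definite scalar product are diagonalisable). [ONeill1983]
-/

noncomputable section

open Set Filter Module Finset

namespace Literature.Geometry.Riemannian

open Lorentzian Lorentzian.PseudoRiemannianMetric
open scoped Manifold ContDiff Topology

/-! ### The sign of the metric pairing of semidefinite forms -/

section Sign

variable {E : Type*} [NormedAddCommGroup E] [NormedSpace ℝ E] {H : Type*} [TopologicalSpace H]
  {I : ModelWithCorners ℝ E H} {M : Type*} [TopologicalSpace M] [ChartedSpace H M]
  [IsManifold I ∞ M] {n : ℕ∞ω} [FiniteDimensional ℝ E]
  (g : PseudoRiemannianMetric I n E (TangentSpace I : M → Type _)) {x : M}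

/-- **Frame computation behind the sign lemmas**: for `P` symmetric with a `g_x`-orthonormal
eigenframe `e`, `P(eᵢ, ·) = μᵢ g_x(eᵢ, ·)`, the metric pairing with any `S` is
`⟨P, S⟩_g = Σᵢ μᵢ S(eᵢ, eᵢ)` (`innerBilin_eq_sum_mul`). [cite: ONeill1983, Ch. 9, Lemma 9.13] -/
theorem innerBilin_eq_sum_eigen (e : Basis (Fin (finrank ℝ E)) ℝ (TangentSpace I x))
    (he : ∀ i j, g.val x (e i) (e j) = if i = j then 1 else 0) {μ : Fin (finrank ℝ E) → ℝ}
    (P S : LinearMap.BilinForm ℝ (TangentSpace I x))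
    (heig : ∀ i (w : TangentSpace I x), P (e i) w = μ i * g.val x (e i) w) :
    g.innerBilin x P S = ∑ i, μ i * S (e i) (e i) := by
  classical
  have hbo : (g.toBilinForm x).IsOrthoᵢ e :=
    LinearMap.BilinForm.iIsOrtho_def.2 fun a c hac ↦ by simp [he, hac]
  have h1 : ∀ a, g.val x (e a) (e a) = 1 := fun a ↦ by simp [he]
  rw [g.innerBilin_eq_sum_mul x e hbo (fun a ↦ by rw [h1 a]; exact one_ne_zero) P S]
  refine Finset.sum_congr rfl fun i _ ↦ ?_
  simp only [h1, mul_one, div_one]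
  rw [Finset.sum_eq_single i]
  · rw [heig, he, if_pos rfl, mul_one]
  · intro j _ hji
    rw [heig, he, if_neg hji, mul_zero, zero_mul]
  · intro hi
    exact absurd (Finset.mem_univ i) hi

/-- A symmetric bilinear form on `T_x M` has a `g_x`-orthonormal eigenframe when `g_x` is
positive definite (`MetricCoord.exists_orthonormal_eigenframe` read on the fibre `T_x M = E`).
[cite: ONeill1983, Ch. 9, Lemma 9.13] -/
theorem exists_orthonormalBasis_eigen (hpos : ∀ v : TangentSpace I x, v ≠ 0 → 0 < g.val x v v)
    (P : LinearMap.BilinForm ℝ (TangentSpace I x)) (hPsymm : ∀ v w, P v w = P w v) :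
    ∃ (e : Basis (Fin (finrank ℝ E)) ℝ (TangentSpace I x)) (μ : Fin (finrank ℝ E) → ℝ),
      (∀ i j, g.val x (e i) (e j) = if i = j then 1 else 0) ∧
        ∀ i (w : TangentSpace I x), P (e i) w = μ i * g.val x (e i) w := by
  -- the continuous version of `P` on the model fibre `E = T_x M`
  let L₁ : (E →ₗ[ℝ] ℝ) →ₗ[ℝ] (E →L[ℝ] ℝ) :=
    (LinearMap.toContinuousLinearMap (𝕜 := ℝ) (E := E) (F' := ℝ)).toLinearMap
  let β : E →L[ℝ] E →L[ℝ] ℝ :=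
    LinearMap.toContinuousLinearMap (L₁ ∘ₗ (P : E →ₗ[ℝ] E →ₗ[ℝ] ℝ))
  have hβ : ∀ v w : E, β v w = P v w := fun v w ↦ rfl
  obtain ⟨e, μ, horth, heig⟩ :=
    MetricCoord.exists_orthonormal_eigenframe (G := fun _ : E ↦ g.val x) (x := (0 : E))
      (fun v w ↦ g.symm x v w) hpos β (fun v w ↦ by rw [hβ, hβ, hPsymm])
  exact ⟨e, μ, horth, fun i w ↦ by rw [← hβ]; exact heig i w⟩

/-- **`⟨P, H⟩_g ≤ 0` for `P` symmetric positive semidefinite and `H` negative semidefinite**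
(`g_x` positive definite): in an orthonormal eigenframe of `P` the pairing is `Σᵢ μᵢ H(eᵢ,eᵢ)`
with `μᵢ = P(eᵢ,eᵢ) ≥ 0` and `H(eᵢ,eᵢ) ≤ 0`. This is the step "the elliptic part is `≤ 0` at a
maximum" of every maximum-principle argument (Gilbarg–Trudinger 2001, proof of Thm. 3.1).
[cite: GilbargTrudinger2001, §3.1, Thm. 3.1] -/
theorem innerBilin_nonpos_of_nonpos (hpos : ∀ v : TangentSpace I x, v ≠ 0 → 0 < g.val x v v)
    {P Hs : LinearMap.BilinForm ℝ (TangentSpace I x)} (hPsymm : ∀ v w, P v w = P w v)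
    (hP : ∀ v, 0 ≤ P v v) (hH : ∀ v, Hs v v ≤ 0) : g.innerBilin x P Hs ≤ 0 := by
  obtain ⟨e, μ, he, heig⟩ := exists_orthonormalBasis_eigen g hpos P hPsymm
  rw [innerBilin_eq_sum_eigen g e he P Hs heig]
  refine Finset.sum_nonpos fun i _ ↦ mul_nonpos_of_nonneg_of_nonpos ?_ (hH _)
  have h := heig i (e i)
  rw [he, if_pos rfl, mul_one] at h
  rw [← h]
  exact hP _

/-- **`⟨P, H⟩_g ≥ 0` for `P` symmetric positive semidefinite and `H` positive semidefinite.**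
[cite: GilbargTrudinger2001, §3.1, Thm. 3.1] -/
theorem innerBilin_nonneg_of_nonneg (hpos : ∀ v : TangentSpace I x, v ≠ 0 → 0 < g.val x v v)
    {P Hs : LinearMap.BilinForm ℝ (TangentSpace I x)} (hPsymm : ∀ v w, P v w = P w v)
    (hP : ∀ v, 0 ≤ P v v) (hH : ∀ v, 0 ≤ Hs v v) : 0 ≤ g.innerBilin x P Hs := by
  obtain ⟨e, μ, he, heig⟩ := exists_orthonormalBasis_eigen g hpos P hPsymm
  rw [innerBilin_eq_sum_eigen g e he P Hs heig]
  refine Finset.sum_nonneg fun i _ ↦ mul_nonneg ?_ (hH _)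
  have h := heig i (e i)
  rw [he, if_pos rfl, mul_one] at h
  rw [← h]
  exact hP _

end Sign

/-! ### Fermat for the covector-valued differential -/

section Fermat

variable {E : Type*} [NormedAddCommGroup E] [NormedSpace ℝ E] {H : Type*} [TopologicalSpace H]
  {I : ModelWithCorners ℝ E H} {M : Type*} [TopologicalSpace M] [ChartedSpace H M]
  [I.Boundaryless]

/-- At a local maximum on a boundaryless manifold the differential `dφ = mvfderiv I φ x`
vanishes (`IsLocalMax.isMCriticalPt`, i.e. `mfderiv = 0`, composed with the identification of
the tangent space of `ℝ`). [folklore] -/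
theorem mvfderiv_eq_zero_of_isLocalMax {φ : M → ℝ} {x : M} (h : IsLocalMax φ x) :
    mvfderiv I φ x = 0 := by
  have hc : mfderiv I 𝓘(ℝ, ℝ) φ x = 0 :=
    Literature.Topology.FourManifolds.IsLocalMax.isMCriticalPt (I := I) h
  ext v
  simp [mvfderiv, hc]

/-- At a local minimum on a boundaryless manifold `mvfderiv I φ x = 0`. [folklore] -/
theorem mvfderiv_eq_zero_of_isLocalMin {φ : M → ℝ} {x : M} (h : IsLocalMin φ x) :
    mvfderiv I φ x = 0 := by
  have hc : mfderiv I 𝓘(ℝ, ℝ) φ x = 0 :=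
    Literature.Topology.FourManifolds.IsLocalMin.isMCriticalPt (I := I) h
  ext v
  simp [mvfderiv, hc]

end Fermat

/-! ### The maximum principle on a closed manifold -/

section MaximumPrinciple

variable {E : Type*} [NormedAddCommGroup E] [NormedSpace ℝ E] {H : Type*} [TopologicalSpace H]
  {I : ModelWithCorners ℝ E H} {M : Type*} [TopologicalSpace M] [ChartedSpace H M]
  [IsManifold I ∞ M] [FiniteDimensional ℝ E] [CompleteSpace E] [I.Boundaryless]
  (g : PseudoRiemannianMetric I ∞ E (TangentSpace I : M → Type _)) [g.HasLeviCivita]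

/-- **At a nonnegative local maximum, `𝓛φ ≤ −c₀ φ`.** For `φ` of class `C²` at a local maximum
`x` with `g_x` positive definite, `P_x` symmetric `≥ 0` and `c(x) ≤ −c₀`, `0 ≤ φ(x)`:
`⟨P, Hess φ⟩_g(x) + dφ_x(b) + c(x)φ(x) ≤ −c₀ φ(x)` (`Hess φ(x) ≤ 0`,
`hessian_apply_self_nonpos_of_isLocalMax`; `dφ_x = 0`). Gilbarg–Trudinger 2001, proof of
Thm. 3.1/3.7. [cite: GilbargTrudinger2001, §3.1, Thm. 3.7] -/
theorem operator_le_at_isLocalMax {x : M} (hpos : ∀ v : TangentSpace I x, v ≠ 0 → 0 < g.val x v v)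
    {P : LinearMap.BilinForm ℝ (TangentSpace I x)} (hPsymm : ∀ v w, P v w = P w v)
    (hP : ∀ v, 0 ≤ P v v) (b : TangentSpace I x) {c c₀ : ℝ} (hc : c ≤ -c₀) {φ : M → ℝ}
    (hφ : ContMDiffAt I 𝓘(ℝ, ℝ) 2 φ x) (hmax : IsLocalMax φ x) (hφx : 0 ≤ φ x) :
    g.innerBilin x P (g.hessian φ x) + mvfderiv I φ x b + c * φ x ≤ -c₀ * φ x := by
  have h1 : g.innerBilin x P (g.hessian φ x) ≤ 0 :=
    innerBilin_nonpos_of_nonpos g hpos hPsymm hP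
      fun v ↦ g.hessian_apply_self_nonpos_of_isLocalMax hφ hmax v
  have h2 : mvfderiv I φ x b = 0 := by
    rw [mvfderiv_eq_zero_of_isLocalMax (I := I) hmax]; rfl
  have h3 : c * φ x ≤ -c₀ * φ x := mul_le_mul_of_nonneg_right hc hφx
  linarith

/-- **At a nonpositive local minimum, `𝓛φ ≥ −c₀ φ`** (the mirror statement).
[cite: GilbargTrudinger2001, §3.1, Thm. 3.7] -/
theorem le_operator_at_isLocalMin {x : M} (hpos : ∀ v : TangentSpace I x, v ≠ 0 → 0 < g.val x v v)
    {P : LinearMap.BilinForm ℝ (TangentSpace I x)} (hPsymm : ∀ v w, P v w = P w v)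
    (hP : ∀ v, 0 ≤ P v v) (b : TangentSpace I x) {c c₀ : ℝ} (hc : c ≤ -c₀) {φ : M → ℝ}
    (hφ : ContMDiffAt I 𝓘(ℝ, ℝ) 2 φ x) (hmin : IsLocalMin φ x) (hφx : φ x ≤ 0) :
    -c₀ * φ x ≤ g.innerBilin x P (g.hessian φ x) + mvfderiv I φ x b + c * φ x := by
  have h1 : 0 ≤ g.innerBilin x P (g.hessian φ x) :=
    innerBilin_nonneg_of_nonneg g hpos hPsymm hP
      fun v ↦ g.hessian_apply_self_nonneg_of_isLocalMin hφ hmin v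
  have h2 : mvfderiv I φ x b = 0 := by
    rw [mvfderiv_eq_zero_of_isLocalMin (I := I) hmin]; rfl
  have h3 : -c₀ * φ x ≤ c * φ x := by nlinarith
  linarith

variable [CompactSpace M]

/-- **The maximum principle on a closed manifold (a priori `C⁰` bound).** Let `M` be compact and
boundaryless, `g` a smooth metric, positive definite; `P_x` symmetric positive semidefinite
bilinear forms, `b` any vector field, `c ≤ −c₀` with `c₀ > 0` (no regularity asked of `P, b, c`);
`φ ∈ C²(M)`. If `|⟨P, Hess_g φ⟩_g + dφ(b) + cφ| ≤ B` everywhere, then `c₀|φ| ≤ B` everywhere: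
evaluate at a maximum and at a minimum of `φ` (`operator_le_at_isLocalMax`,
`le_operator_at_isLocalMin`). The closed-manifold form of Gilbarg–Trudinger 2001, Thm. 3.7
(`sup|u| ≤ sup|u|_{∂Ω} + sup|Lu|/λ…`; here `∂M = ∅` and `c ≤ −c₀` replaces the barrier), and the
quantitative content of "the coefficient of `φ` in the zeroth-order term is strictly negative"
in Gursky–Viaclovsky 2003, proof of Prop. 2. [cite: GilbargTrudinger2001, §3.1, Thm. 3.7]
[cite: GurskyViaclovsky2003, §2, proof of Prop. 2] -/
theorem mul_abs_le_of_maximumPrinciple (hpos : ∀ (x : M) (v : TangentSpace I x), v ≠ 0 → 0 < g.val x v v)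
    {P : Π x : M, LinearMap.BilinForm ℝ (TangentSpace I x)} (hPsymm : ∀ x v w, P x v w = P x w v)
    (hP : ∀ x v, 0 ≤ P x v v) (b : Π x : M, TangentSpace I x) {c : M → ℝ} {c₀ : ℝ}
    (hc₀ : 0 < c₀) (hc : ∀ x, c x ≤ -c₀) {φ : M → ℝ} (hφ : ContMDiff I 𝓘(ℝ, ℝ) 2 φ) {B : ℝ}
    (hB : ∀ x, |g.innerBilin x (P x) (g.hessian φ x) + mvfderiv I φ x (b x) + c x * φ x| ≤ B)
    (x : M) : c₀ * |φ x| ≤ B := by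
  have hcont : Continuous φ := hφ.continuous
  have hB0 : 0 ≤ B := (abs_nonneg _).trans (hB x)
  -- a maximum point and a minimum point of `φ`
  obtain ⟨x₀, -, hx₀⟩ := isCompact_univ.exists_isMaxOn ⟨x, mem_univ x⟩ hcont.continuousOn
  obtain ⟨x₁, -, hx₁⟩ := isCompact_univ.exists_isMinOn ⟨x, mem_univ x⟩ hcont.continuousOn
  have hmax : IsLocalMax φ x₀ := hx₀.isLocalMax univ_mem
  have hmin : IsLocalMin φ x₁ := hx₁.isLocalMin univ_mem
  -- `c₀ φ(x₀) ≤ B`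
  have hup : c₀ * φ x₀ ≤ B := by
    rcases le_or_gt (φ x₀) 0 with h0 | h0
    · exact (mul_nonpos_of_nonneg_of_nonpos hc₀.le h0).trans hB0
    · have key := operator_le_at_isLocalMax g (hpos x₀) (hPsymm x₀) (hP x₀) (b x₀) (hc x₀)
        (hφ x₀) hmax h0.le
      have hb := hB x₀
      rw [abs_le] at hb
      linarith [hb.1]
  -- `-c₀ φ(x₁) ≤ B`
  have hdown : -c₀ * φ x₁ ≤ B := by
    rcases le_or_gt 0 (φ x₁) with h0 | h0
    · have : -c₀ * φ x₁ ≤ 0 := by nlinarith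
      exact this.trans hB0
    · have key := le_operator_at_isLocalMin g (hpos x₁) (hPsymm x₁) (hP x₁) (b x₁) (hc x₁)
        (hφ x₁) hmin h0.le
      have hb := hB x₁
      rw [abs_le] at hb
      linarith [hb.2]
  -- conclude at `x`
  have hle : φ x ≤ φ x₀ := hx₀ (mem_univ x)
  have hge : φ x₁ ≤ φ x := hx₁ (mem_univ x)
  rcases le_or_gt 0 (φ x) with h0 | h0
  · rw [abs_of_nonneg h0]
    nlinarith
  · rw [abs_of_neg h0]
    nlinarith

/-- **`Ker 𝓛 ∩ C²(M) = 0` on a closed manifold** for `𝓛φ = ⟨P, Hess_g φ⟩_g + dφ(b) + cφ` with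
`P` symmetric `≥ 0` and `c ≤ −c₀ < 0`: the injectivity half of "the linearization is
furthermore invertible" (Gursky–Viaclovsky 2003, proof of Prop. 2; Gilbarg–Trudinger 2001,
Cor. 3.8 on domains). [cite: GurskyViaclovsky2003, §2, proof of Prop. 2]
[cite: GilbargTrudinger2001, §3.1, Cor. 3.8] -/
theorem eq_zero_of_maximumPrinciple (hpos : ∀ (x : M) (v : TangentSpace I x), v ≠ 0 → 0 < g.val x v v)
    {P : Π x : M, LinearMap.BilinForm ℝ (TangentSpace I x)} (hPsymm : ∀ x v w, P x v w = P x w v)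
    (hP : ∀ x v, 0 ≤ P x v v) (b : Π x : M, TangentSpace I x) {c : M → ℝ} {c₀ : ℝ}
    (hc₀ : 0 < c₀) (hc : ∀ x, c x ≤ -c₀) {φ : M → ℝ} (hφ : ContMDiff I 𝓘(ℝ, ℝ) 2 φ)
    (hL : ∀ x, g.innerBilin x (P x) (g.hessian φ x) + mvfderiv I φ x (b x) + c x * φ x = 0) :
    φ = 0 := by
  funext x
  have h := mul_abs_le_of_maximumPrinciple g hpos hPsymm hP b hc₀ hc hφ (B := 0)
    (fun y ↦ by rw [hL y, abs_zero]) x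
  have h' : |φ x| ≤ 0 := by nlinarith [abs_nonneg (φ x)]
  exact abs_eq_zero.1 (le_antisymm h' (abs_nonneg _))

end MaximumPrinciple

end Literature.Geometry.Riemannian

end
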